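import Summits.RiemannHypothesis.RiemannHypothesis.Theorems.PfPersistenceF1Beurling
import Literature.NumberTheory.LFunctions.WeilWindowSimpleEven
import HarnessLib

/-!
# PF persistence, fake seat 1 — THEOREM F1-B: the translate bound (kernel half)

Unit `pub-rhpf-fake-1` of the `pub-rhpf` cell (mechanism / rigidity campaign; **no RH claims**);
companion of `HOME/FAKES.md §1.6`.  Nothing here asserts or assumes RH.

**THEOREM F1-B (abstract half, PROVED).**  `Φ` additive and `ℂ`-homogeneous on Weil tests
(`IsTestLinear Φ`) with `0 ≤ Re Φ(g ⋆ g̃)` on Weil tests (`ConePositive Φ`) satisfies, for every Weil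
test `θ`, `A := θ ⋆ θ̃`, `τ_X A := A(· − X)`:  `|Re Φ(τ_X A) + Re Φ(τ_{−X} A)| ≤ 2 Re Φ(A)`
(`translate_pair_bound`) and `‖Φ(τ_X A) + conj Φ(τ_{−X} A)‖ ≤ 2 Re Φ(A)` (`translate_pair_norm_bound`).
Proof: expand `Φ((θ + c θ_X) ⋆ (θ + c θ_X)~) ≥ 0` using `θ_X ⋆ θ̃_X = A`, `θ_X ⋆ θ̃ = τ_X A`,
`θ ⋆ θ̃_X = τ_{−X} A` — a `2 × 2` PSD statement, free of `ζ`, of the functional equation and of the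
explicit formula.  Instances (PROVED): `weilFunctional` (`weil_translate_pair_bound`); every
`ExplicitDatum` with `ζ`'s smooth part and locally finite atoms (`ExplicitDatum.translate_pair_bound`,
`not_positivity_of_translatePairUnbounded`); the Beurling data of `PfPersistenceF1Beurling`
(`locallyFiniteAtoms_beurlingDatum`, `beurling_not_positivity_of_unbounded`).

**THEOREM F1-C (analytic half; informal proof in FAKES §1.6, kernel OPEN, typed as
`BoundedTranslatesForceContinuation`).**  Bounded translate pairs force `−ζ_P'/ζ_P` to continue
analytically to `{Re s > 1/2} ∖ {1}` (Laplace transform in `X`); so every g-prime system whose `ζ_P`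
is obstructed there — e.g. the DMV twins with `β > 1/2` (zeros at `β ± iγ`, THEOREM F1-Z) — is not
Weil-positive, and GAP `F1-G-b` shrinks to the systems with `ζ_P` holomorphic zero-free on `Re s > 1/2`.
-/

set_option linter.dupNamespace false

noncomputable section

open MeasureTheory Set Filter Complex
open scoped Real Topology ComplexConjugate ContDiff

namespace Summit.RiemannHypothesis.RiemannHypothesis.Theorems.PfPersistence.Fake1.TranslateBound

open Literature.NumberTheory.LFunctions Summit.RiemannHypothesis.RiemannHypothesis.Theorems.PfPersistenceBarrier
  Summit.RiemannHypothesis.RiemannHypothesis.Theorems.PfPersistenceBarrier.ExplicitDatum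
  Summit.RiemannHypothesis.RiemannHypothesis.Theorems.PfPersistence.Fake1

variable {Φ : (ℝ → ℂ) → ℂ} {g h θ k : ℝ → ℂ}

/-! ## §1 Test-linear functionals and cone positivity -/

/-- `Φ` is additive and `ℂ`-homogeneous on Weil test functions. [folklore] -/
structure IsTestLinear (Φ : (ℝ → ℂ) → ℂ) : Prop where
  map_add : ∀ ⦃k₁ k₂ : ℝ → ℂ⦄, IsWeilTest k₁ → IsWeilTest k₂ → Φ (k₁ + k₂) = Φ k₁ + Φ k₂
  map_const_mul : ∀ (c : ℂ) ⦃k : ℝ → ℂ⦄, IsWeilTest k → Φ (fun t ↦ c * k t) = c * Φ k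

/-- `Φ` is nonnegative on the autocorrelation cone: `0 ≤ Re Φ(g ⋆ g̃)` for Weil tests `g`. [folklore] -/
def ConePositive (Φ : (ℝ → ℂ) → ℂ) : Prop :=
  ∀ ⦃g : ℝ → ℂ⦄, IsWeilTest g → 0 ≤ (Φ (weilConv g (weilReflect g))).re

/-! ## §2 Translates through reflection and convolution -/

/-- `(τ_X g)~ = τ_{−X} g̃`. [folklore] -/
theorem weilReflect_weilTranslate (g : ℝ → ℂ) (X : ℝ) :
    weilReflect (weilTranslate g X) = weilTranslate (weilReflect g) (-X) := by
  funext t; simp only [weilReflect, weilTranslate]; ring_nf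

/-- `(τ_X g) ⋆ h = τ_X (g ⋆ h)`. [folklore] -/
theorem weilConv_weilTranslate_left (g h : ℝ → ℂ) (X : ℝ) :
    weilConv (weilTranslate g X) h = weilTranslate (weilConv g h) X := by
  funext t
  show weilConv (weilTranslate g X) h t = weilConv g h (t - X)
  rw [weilConv_apply, weilConv_apply,
    ← integral_sub_right_eq_self (μ := (volume : Measure ℝ)) (fun u : ℝ ↦ g u * h (t - X - u)) X]
  congr 1 with u
  simp only [weilTranslate]
  ring_nf

/-- `g ⋆ (τ_X h) = τ_X (g ⋆ h)`. [folklore] -/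
theorem weilConv_weilTranslate_right (g h : ℝ → ℂ) (X : ℝ) :
    weilConv g (weilTranslate h X) = weilTranslate (weilConv g h) X := by
  funext t
  show weilConv g (weilTranslate h X) t = weilConv g h (t - X)
  rw [weilConv_apply, weilConv_apply]
  congr 1 with u
  simp only [weilTranslate]
  ring_nf

/-- Autocorrelations are translation invariant: `(τ_X θ) ⋆ (τ_X θ)~ = θ ⋆ θ̃`. [folklore] -/
theorem autocorr_weilTranslate (θ : ℝ → ℂ) (X : ℝ) :
    weilConv (weilTranslate θ X) (weilReflect (weilTranslate θ X)) = weilConv θ (weilReflect θ) := by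
  rw [weilReflect_weilTranslate, weilConv_weilTranslate_left, weilConv_weilTranslate_right]
  funext t; simp only [weilTranslate, sub_neg_eq_add, sub_add_cancel]

/-- The cross term `θ ⋆ (τ_X θ)~ = τ_{−X} (θ ⋆ θ̃)`. [folklore] -/
theorem cross_weilTranslate_right (θ : ℝ → ℂ) (X : ℝ) :
    weilConv θ (weilReflect (weilTranslate θ X)) = weilTranslate (weilConv θ (weilReflect θ)) (-X) := by
  rw [weilReflect_weilTranslate, weilConv_weilTranslate_right]

/-! ## §3 Polarisation of the autocorrelation and the translate bound -/

/-- `(g + c h) ⋆ (g + c h)~ = g ⋆ g̃ + c̄ (g ⋆ h̃) + c (h ⋆ g̃) + c c̄ (h ⋆ h̃)`. [folklore] -/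
theorem autocorr_add_const_mul (hg : IsWeilTest g) (hh : IsWeilTest h) (c : ℂ) :
    weilConv (g + fun t ↦ c * h t) (weilReflect (g + fun t ↦ c * h t)) =
      weilConv g (weilReflect g) + (fun t ↦ conj c * weilConv g (weilReflect h) t) +
        ((fun t ↦ c * weilConv h (weilReflect g) t) +
          fun t ↦ c * (conj c * weilConv h (weilReflect h) t)) := by
  have hch : IsWeilTest (fun t ↦ c * h t) := hh.const_mul c
  have hcr : IsWeilTest (fun t ↦ conj c * weilReflect h t) := hh.weilReflect.const_mul _
  rw [weilReflect_add, weilReflect_const_mul, weilConv_add_left hg hch (hg.weilReflect.add hcr),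
    weilConv_add_right hg hg.weilReflect hcr, weilConv_add_right hch hg.weilReflect hcr,
    weilConv_const_mul_right (conj c) g (weilReflect h), weilConv_const_mul_left c h (weilReflect g),
    weilConv_const_mul_left c h (fun t ↦ conj c * weilReflect h t),
    weilConv_const_mul_right (conj c) h (weilReflect h)]

/-- Polarisation for a test-linear `Φ`:
`Φ((g + c h) ⋆ (g + c h)~) = Φ(g ⋆ g̃) + c̄ Φ(g ⋆ h̃) + c Φ(h ⋆ g̃) + c c̄ Φ(h ⋆ h̃)`. [folklore] -/
theorem IsTestLinear.quad_add_const_mul (hΦ : IsTestLinear Φ) (hg : IsWeilTest g)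
    (hh : IsWeilTest h) (c : ℂ) :
    Φ (weilConv (g + fun t ↦ c * h t) (weilReflect (g + fun t ↦ c * h t))) =
      Φ (weilConv g (weilReflect g)) + conj c * Φ (weilConv g (weilReflect h)) +
        (c * Φ (weilConv h (weilReflect g)) + c * (conj c * Φ (weilConv h (weilReflect h)))) := by
  have hA : IsWeilTest (weilConv g (weilReflect g)) := hg.weilConv hg.weilReflect
  have hB₀ : IsWeilTest (weilConv g (weilReflect h)) := hg.weilConv hh.weilReflect
  have hC₀ : IsWeilTest (weilConv h (weilReflect g)) := hh.weilConv hg.weilReflect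
  have hD₀ : IsWeilTest (weilConv h (weilReflect h)) := hh.weilConv hh.weilReflect
  have hB : IsWeilTest (fun t ↦ conj c * weilConv g (weilReflect h) t) := hB₀.const_mul _
  have hC : IsWeilTest (fun t ↦ c * weilConv h (weilReflect g) t) := hC₀.const_mul _
  have hD₁ : IsWeilTest (fun t ↦ conj c * weilConv h (weilReflect h) t) := hD₀.const_mul _
  have hD : IsWeilTest (fun t ↦ c * (conj c * weilConv h (weilReflect h) t)) := hD₁.const_mul c
  rw [autocorr_add_const_mul hg hh c, hΦ.map_add (hA.add hB) (hC.add hD), hΦ.map_add hA hB,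
    hΦ.map_add hC hD, hΦ.map_const_mul (conj c) hB₀, hΦ.map_const_mul c hC₀,
    hΦ.map_const_mul c hD₁, hΦ.map_const_mul (conj c) hD₀]

/-- The `2 × 2` expansion: `0 ≤ Re[Φ(A) + c̄ Φ(τ_{−X}A) + c Φ(τ_X A) + c c̄ Φ(A)]` for every `c`. [folklore] -/
theorem IsTestLinear.key_expansion (hΦ : IsTestLinear Φ) (hpos : ConePositive Φ) (hθ : IsWeilTest θ)
    (X : ℝ) (c : ℂ) :
    0 ≤ (Φ (weilConv θ (weilReflect θ)) +
          conj c * Φ (weilTranslate (weilConv θ (weilReflect θ)) (-X)) +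
        (c * Φ (weilTranslate (weilConv θ (weilReflect θ)) X) +
          c * (conj c * Φ (weilConv θ (weilReflect θ))))).re := by
  have h0 := hpos (hθ.add ((hθ.weilTranslate X).const_mul c))
  rwa [hΦ.quad_add_const_mul hθ (hθ.weilTranslate X) c, autocorr_weilTranslate,
    cross_weilTranslate_right, weilConv_weilTranslate_left] at h0

/-- **THEOREM F1-B (abstract half): the translate bound.**  A test-linear functional nonnegative on
the autocorrelation cone satisfies `|Re Φ(τ_X A) + Re Φ(τ_{−X} A)| ≤ 2 Re Φ(A)` for `A = θ ⋆ θ̃`,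
`θ` any Weil test, `X` any real. [folklore] -/
theorem translate_pair_bound (hΦ : IsTestLinear Φ) (hpos : ConePositive Φ) (hθ : IsWeilTest θ)
    (X : ℝ) :
    |(Φ (weilTranslate (weilConv θ (weilReflect θ)) X)).re +
        (Φ (weilTranslate (weilConv θ (weilReflect θ)) (-X))).re| ≤
      2 * (Φ (weilConv θ (weilReflect θ))).re := by
  have h1 := hΦ.key_expansion hpos hθ X 1
  have h2 := hΦ.key_expansion hpos hθ X (-1)
  simp only [map_one, one_mul, add_re] at h1
  simp only [map_neg, map_one, neg_mul, one_mul, neg_neg, add_re, neg_re] at h2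
  exact abs_le.2 ⟨by linarith, by linarith⟩

/-- If `Re(λ w) ≤ M` for every unit `λ`, then `‖w‖ ≤ M`. [folklore] -/
theorem norm_le_of_re_rot_le {w : ℂ} {M : ℝ} (h : ∀ l : ℂ, ‖l‖ = 1 → (l * w).re ≤ M) : ‖w‖ ≤ M := by
  by_cases hw : w = 0
  · have h1 := h 1 (by simp)
    rw [hw, norm_zero]
    simpa [hw] using h1
  · have hn : ‖w‖ ≠ 0 := norm_ne_zero_iff.2 hw
    have h1 := h (((‖w‖⁻¹ : ℝ) : ℂ) * conj w) (by
      rw [norm_mul, Complex.norm_real, norm_inv, norm_norm, Complex.norm_conj, inv_mul_cancel₀ hn])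
    rwa [mul_assoc, Complex.conj_mul', ← Complex.ofReal_pow, ← Complex.ofReal_mul, Complex.ofReal_re,
      pow_two, ← mul_assoc, inv_mul_cancel₀ hn, one_mul] at h1

/-- **THEOREM F1-B, phase form:** `‖Φ(τ_X A) + conj Φ(τ_{−X} A)‖ ≤ 2 Re Φ(A)` (rotate the second
test by a unit scalar before expanding). [folklore] -/
theorem translate_pair_norm_bound (hΦ : IsTestLinear Φ) (hpos : ConePositive Φ) (hθ : IsWeilTest θ)
    (X : ℝ) :
    ‖Φ (weilTranslate (weilConv θ (weilReflect θ)) X) +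
        conj (Φ (weilTranslate (weilConv θ (weilReflect θ)) (-X)))‖ ≤
      2 * (Φ (weilConv θ (weilReflect θ))).re := by
  refine norm_le_of_re_rot_le fun l hl ↦ ?_
  have hcc : l * conj l = 1 := by
    rw [Complex.mul_conj', hl]
    simp
  have h2 := hΦ.key_expansion hpos hθ X (-l)
  simp only [map_neg, neg_mul, mul_neg, neg_neg, ← mul_assoc, hcc, one_mul, add_re, neg_re] at h2
  have e : (l * (Φ (weilTranslate (weilConv θ (weilReflect θ)) X) +
        conj (Φ (weilTranslate (weilConv θ (weilReflect θ)) (-X))))).re =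
      (l * Φ (weilTranslate (weilConv θ (weilReflect θ)) X)).re +
        (conj l * Φ (weilTranslate (weilConv θ (weilReflect θ)) (-X))).re := by
    rw [mul_add, add_re, ← Complex.conj_re (conj l * _), map_mul, Complex.conj_conj]
  rw [e]
  linarith

/-- Hermitian case of the phase form: if `Φ(τ_{−X} A) = conj Φ(τ_X A)` (e.g. `Φ` real on real even
tests and `θ` real even), then `‖Φ(τ_X A)‖ ≤ Re Φ(A)`. [folklore] -/
theorem translate_norm_bound_of_conj (hΦ : IsTestLinear Φ) (hpos : ConePositive Φ)
    (hθ : IsWeilTest θ) (X : ℝ)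
    (hsymm : Φ (weilTranslate (weilConv θ (weilReflect θ)) (-X)) =
      conj (Φ (weilTranslate (weilConv θ (weilReflect θ)) X))) :
    ‖Φ (weilTranslate (weilConv θ (weilReflect θ)) X)‖ ≤ (Φ (weilConv θ (weilReflect θ))).re := by
  have h := translate_pair_norm_bound hΦ hpos hθ X
  rw [hsymm, Complex.conj_conj, ← two_mul, norm_mul, Complex.norm_two] at h
  linarith

/-! ## §4 Instance: the Weil functional of `ζ` -/

/-- `weilFunctional` is test-linear (`weilFunctional_add`, `weilFunctional_const_mul`). [folklore] -/
theorem isTestLinear_weilFunctional : IsTestLinear weilFunctional where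
  map_add := fun _ _ hk₁ hk₂ ↦ weilFunctional_add hk₁ hk₂
  map_const_mul := fun c k _ ↦ weilFunctional_const_mul c k

/-- Cone positivity of `weilFunctional` is `WeilPositivity`. [folklore] -/
theorem conePositive_weilFunctional_iff : ConePositive weilFunctional ↔ WeilPositivity :=
  ⟨fun h _ hg ↦ h hg, fun h g hg ↦ h g hg⟩

/-- **F1-B for `ζ`:** Weil positivity bounds every translate pair:
`|Re W(τ_X(θ ⋆ θ̃)) + Re W(τ_{−X}(θ ⋆ θ̃))| ≤ 2 Re Q(θ)`. (No claim that the hypothesis holds.) [folklore] -/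
theorem weil_translate_pair_bound (hW : WeilPositivity) (hθ : IsWeilTest θ) (X : ℝ) :
    |(weilFunctional (weilTranslate (weilConv θ (weilReflect θ)) X)).re +
        (weilFunctional (weilTranslate (weilConv θ (weilReflect θ)) (-X))).re| ≤
      2 * (weilQuadratic θ).re :=
  translate_pair_bound isTestLinear_weilFunctional (conePositive_weilFunctional_iff.2 hW) hθ X

/-! ## §5 Instance: explicit-formula data with `ζ`'s smooth part and locally finite atoms -/

/-- The atoms of `F` are LOCALLY FINITE: only finitely many nonzero weights sit at positions of
modulus `≤ B`, for every `B`. (Holds for `ζ` and for every g-prime system without finite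
accumulation point; fails for data with accumulating positions, where `primeTerm` is a junk `tsum`.)
[folklore] -/
def LocallyFiniteAtoms (F : ExplicitDatum) : Prop :=
  ∀ B : ℝ, {i : ℕ | F.wt i ≠ 0 ∧ |F.pos i| ≤ B}.Finite

/-- A compactly supported test lives on some window `[-B, B]`. [folklore] -/
theorem exists_tsupport_subset_Icc (hk : HasCompactSupport k) : ∃ B : ℝ, tsupport k ⊆ Icc (-B) B := by
  obtain ⟨R, hR⟩ := hk.isCompact.isBounded.subset_closedBall 0
  refine ⟨R, hR.trans ?_⟩
  rw [Real.closedBall_eq_Icc, zero_sub, zero_add]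

/-- Under local finiteness the prime-type series of a compactly supported test is a finite sum. [folklore] -/
theorem summable_primeTerm {F : ExplicitDatum} (hF : LocallyFiniteAtoms F)
    (hk : HasCompactSupport k) :
    Summable fun i : ℕ ↦ F.wt i * (k (F.pos i) + k (-F.pos i)) := by
  obtain ⟨B, hB⟩ := exists_tsupport_subset_Icc hk
  refine summable_of_ne_finset_zero (s := (hF B).toFinset) fun i hi ↦ ?_
  rw [Set.Finite.mem_toFinset, Set.mem_setOf_eq, not_and_or, not_not, not_le] at hi
  rcases hi with hi | hi
  · rw [hi, zero_mul]
  · rw [apply_eq_zero_of_tsupport_subset hB hi,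
      apply_eq_zero_of_tsupport_subset hB (by rwa [abs_neg]), add_zero, mul_zero]

/-- The prime-type term of locally finite data is test-linear. [folklore] -/
theorem isTestLinear_primeTerm {F : ExplicitDatum} (hF : LocallyFiniteAtoms F) :
    IsTestLinear F.primeTerm where
  map_add := by
    intro k₁ k₂ hk₁ hk₂
    unfold ExplicitDatum.primeTerm
    rw [← (summable_primeTerm hF hk₁.2).tsum_add (summable_primeTerm hF hk₂.2)]
    refine tsum_congr fun i ↦ ?_
    simp only [Pi.add_apply]
    ring
  map_const_mul := by
    intro c k _
    unfold ExplicitDatum.primeTerm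
    rw [← tsum_mul_left]
    refine tsum_congr fun i ↦ ?_
    ring

/-- `ζ`'s smooth part `k ↦ ĝ(0) + ĝ(1) + W_∞(k)` is test-linear. [folklore] -/
theorem isTestLinear_zetaSmooth : IsTestLinear zetaC.smooth where
  map_add := by
    intro k₁ k₂ hk₁ hk₂
    change weilPolarTerm (k₁ + k₂) + weilArchTerm (k₁ + k₂) =
      weilPolarTerm k₁ + weilArchTerm k₁ + (weilPolarTerm k₂ + weilArchTerm k₂)
    simp only [weilPolarTerm, weilArchTerm,
      weilMellin_add hk₁.1.continuous hk₁.2 hk₂.1.continuous hk₂.2, weilArchIntegral_add hk₁ hk₂,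
      Pi.add_apply]
    ring
  map_const_mul := by
    intro c k _
    change weilPolarTerm (fun t ↦ c * k t) + weilArchTerm (fun t ↦ c * k t) =
      c * (weilPolarTerm k + weilArchTerm k)
    have hAI : weilArchIntegral (fun t ↦ c * k t) = c * weilArchIntegral k := by
      simp only [weilArchIntegral, weilMellin_const_mul]
      rw [← integral_const_mul]
      congr 1 with t
      ring
    simp only [weilPolarTerm, weilArchTerm, weilMellin_const_mul, hAI]
    ring

/-- The functional of a datum with `ζ`'s smooth part and locally finite atoms is test-linear. [folklore] -/
theorem isTestLinear_functional {F : ExplicitDatum} (hs : F.smooth = zetaC.smooth)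
    (hF : LocallyFiniteAtoms F) : IsTestLinear F.functional where
  map_add := by
    intro k₁ k₂ hk₁ hk₂
    simp only [ExplicitDatum.functional, hs, isTestLinear_zetaSmooth.map_add hk₁ hk₂,
      (isTestLinear_primeTerm hF).map_add hk₁ hk₂]
    ring
  map_const_mul := by
    intro c k hk
    simp only [ExplicitDatum.functional, hs, isTestLinear_zetaSmooth.map_const_mul c hk,
      (isTestLinear_primeTerm hF).map_const_mul c hk]
    ring

/-- Cone positivity of `F.functional` is `F.Positivity`. [folklore] -/
theorem conePositive_functional_iff (F : ExplicitDatum) :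
    ConePositive F.functional ↔ F.Positivity :=
  ⟨fun h _ hg ↦ h hg, fun h g hg ↦ h g hg⟩

/-- **F1-B for explicit-formula data:** positivity of `W_F` bounds every translate pair,
`|Re W_F(τ_X(θ ⋆ θ̃)) + Re W_F(τ_{−X}(θ ⋆ θ̃))| ≤ 2 Re Q_F(θ)`. [folklore] -/
theorem ExplicitDatum.translate_pair_bound {F : ExplicitDatum} (hs : F.smooth = zetaC.smooth)
    (hF : LocallyFiniteAtoms F) (hP : F.Positivity) (hθ : IsWeilTest θ) (X : ℝ) :
    |(F.functional (weilTranslate (weilConv θ (weilReflect θ)) X)).re +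
        (F.functional (weilTranslate (weilConv θ (weilReflect θ)) (-X))).re| ≤
      2 * (F.quadratic θ).re :=
  TranslateBound.translate_pair_bound (isTestLinear_functional hs hF)
    ((conePositive_functional_iff F).2 hP) hθ X

/-- `F` has UNBOUNDED TRANSLATE PAIRS: for some Weil test `θ` the quantities
`Re W_F(τ_X(θ ⋆ θ̃)) + Re W_F(τ_{−X}(θ ⋆ θ̃))` are unbounded in `X`. [folklore] -/
def TranslatePairUnbounded (F : ExplicitDatum) : Prop :=
  ∃ θ : ℝ → ℂ, IsWeilTest θ ∧ ∀ M : ℝ, ∃ X : ℝ,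
    M < |(F.functional (weilTranslate (weilConv θ (weilReflect θ)) X)).re +
          (F.functional (weilTranslate (weilConv θ (weilReflect θ)) (-X))).re|

/-- Unbounded translate pairs refute positivity (data with `ζ`'s smooth part, locally finite atoms).
[folklore] -/
theorem not_positivity_of_translatePairUnbounded {F : ExplicitDatum} (hs : F.smooth = zetaC.smooth)
    (hF : LocallyFiniteAtoms F) (h : TranslatePairUnbounded F) : ¬ F.Positivity := by
  rintro hP
  obtain ⟨θ, hθ, hM⟩ := h
  obtain ⟨X, hX⟩ := hM (2 * (F.quadratic θ).re)
  exact (not_lt.2 (ExplicitDatum.translate_pair_bound hs hF hP hθ X)) hX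

/-! ## §6 Instance: Beurling data -/

/-- `Nat.unpair` is injective (it is the inverse of `Nat.pair`). [folklore] -/
theorem unpair_injOn (s : Set ℕ) : Set.InjOn Nat.unpair s := fun a _ b _ h ↦ by
  rw [← Nat.pair_unpair a, ← Nat.pair_unpair b, h]

/-- A g-prime system with generators `> 1` and no finite accumulation point (finitely many generators
below every bound — all census members B1/B2/B3 of FAKES §1) has locally finite atoms. [folklore] -/
theorem locallyFiniteAtoms_beurlingDatum {g : ℕ → ℝ} (m : ℕ → ℕ) (hg : ∀ i, 1 < g i)
    (hfin : ∀ B : ℝ, {i : ℕ | g i ≤ B}.Finite) : LocallyFiniteAtoms (beurlingDatum g m) := by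
  intro B
  have hT : (⋃ i ∈ {i : ℕ | g i ≤ Real.exp B},
      ({i} : Set ℕ) ×ˢ {k : ℕ | ((k : ℝ) + 1) * Real.log (g i) ≤ B}).Finite := by
    refine (hfin _).biUnion fun i _ ↦ (Set.finite_singleton i).prod ?_
    have hL : 0 < Real.log (g i) := Real.log_pos (hg i)
    refine (Set.finite_le_nat ⌊B / Real.log (g i)⌋₊).subset fun k hk ↦ ?_
    rw [Set.mem_setOf_eq] at hk ⊢
    refine Nat.le_floor ?_
    rw [le_div_iff₀ hL]
    have hk' := mul_le_mul_of_nonneg_right (by linarith : (k : ℝ) ≤ k + 1) hL.le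
    linarith
  refine (hT.preimage (unpair_injOn _)).subset fun n hn ↦ ?_
  obtain ⟨-, hB⟩ := hn
  change |((n.unpair.2 : ℝ) + 1) * Real.log (g n.unpair.1)| ≤ B at hB
  have hL : 0 < Real.log (g n.unpair.1) := Real.log_pos (hg _)
  have hposB : ((n.unpair.2 : ℝ) + 1) * Real.log (g n.unpair.1) ≤ B := (le_abs_self _).trans hB
  have h1 : Real.log (g n.unpair.1) ≤ B :=
    (le_mul_of_one_le_left hL.le (by linarith [(Nat.cast_nonneg _ : (0 : ℝ) ≤ n.unpair.2)])).trans
      hposB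
  simp only [Set.mem_preimage, Set.mem_iUnion, Set.mem_prod, Set.mem_singleton_iff,
    Set.mem_setOf_eq, exists_prop]
  refine ⟨n.unpair.1, ?_, rfl, hposB⟩
  calc g n.unpair.1 = Real.exp (Real.log (g n.unpair.1)) :=
      (Real.exp_log (by linarith [hg n.unpair.1])).symm
    _ ≤ Real.exp B := Real.exp_le_exp.2 h1

/-- **F1-B for Beurling data:** a g-prime system with generators `> 1`, no finite accumulation point
and unbounded translate pairs is not Weil-positive — the kernel form in which FAKES §1.6 discharges
`BeurlingRigidity` on the DMV-type members with an off-line zero `β > 1/2` (the unboundedness is the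
informal analytic half). [folklore] -/
theorem beurling_not_positivity_of_unbounded {g : ℕ → ℝ} (m : ℕ → ℕ) (hg : ∀ i, 1 < g i)
    (hfin : ∀ B : ℝ, {i : ℕ | g i ≤ B}.Finite) (h : TranslatePairUnbounded (beurlingDatum g m)) :
    ¬ (beurlingDatum g m).Positivity :=
  not_positivity_of_translatePairUnbounded rfl (locallyFiniteAtoms_beurlingDatum m hg hfin) h

/-! ## §7 Typed target: the analytic half (kernel OPEN; THEOREM F1-C, informal, FAKES §1.6) -/

/-- The von Mangoldt Dirichlet series of a datum, `Z_F(w) = Σᵢ wtᵢ e^{−(w − 1/2) posᵢ}` (for `ζ`: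
`Σ Λ(n) n^{−w} = −ζ'/ζ(w)`; for `beurlingDatum g m`: `−ζ_P'/ζ_P(w)`), where it converges. [folklore] -/
def primeDirichlet (F : ExplicitDatum) (w : ℂ) : ℂ :=
  ∑' i : ℕ, F.wt i * Complex.exp (-(w - 1 / 2) * (F.pos i : ℂ))

/-- THEOREM F1-C "LAPLACE RIGIDITY" (informal proof in FAKES §1.6; kernel OPEN — a typed target, not
used above): for a datum with `ζ`'s smooth part, real weights at positive positions, locally finite
atoms and `Z_F` absolutely convergent on `Re w > 1`, BOUNDED translate pairs (in particular
`F.Positivity`, by `not_positivity_of_translatePairUnbounded`) force `Z_F` to continue analytically to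
`{Re w > 1/2} ∖ {1}`: the Laplace transform in `X` of `Re W_F(τ_X(θ ⋆ θ̃))` is `Â(w) Z_F(w)` plus terms
meromorphic on `Re w > 1/2` with only the polar pole at `w = 1`.  Contrapositive: a g-prime system whose
`ζ_P` has a zero, a pole `≠ 1` or a branch point in `Re s > 1/2` (every DMV twin with `β > 1/2`,
THEOREM F1-Z) is not Weil-positive. (A `Prop`: statement only, a problem-side typed target of the
campaign with the label stated above; not a Literature fact, not cited from anywhere.) -/
def BoundedTranslatesForceContinuation : Prop :=
  ∀ F : ExplicitDatum, F.smooth = zetaC.smooth → LocallyFiniteAtoms F → (∀ i, (F.wt i).im = 0) →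
    (∀ i, F.wt i ≠ 0 → 0 < F.pos i) →
    (∀ σ : ℝ, 1 < σ → Summable fun i ↦ ‖F.wt i‖ * Real.exp (-(σ - 1 / 2) * F.pos i)) →
    ¬ TranslatePairUnbounded F →
    ∃ G : ℂ → ℂ, DifferentiableOn ℂ G {w : ℂ | 1 / 2 < w.re ∧ w ≠ 1} ∧
      ∀ w : ℂ, 1 < w.re → G w = primeDirichlet F w

end Summit.RiemannHypothesis.RiemannHypothesis.Theorems.PfPersistence.Fake1.TranslateBound

end
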